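import Mathlib
import Literature.Analysis.FluidPDE.FluidComputer.GalerkinEnergyBalance
import Literature.Analysis.FluidPDE.FluidComputer.EnstrophyCurvature
import HarnessLib

/-!
# The sparse-support ceiling for the tree's own Galerkin-truncated Navier–Stokes system

HONEST FRAMING (cell `ns-blowup`, seat `ns-blowup-circuit`, human ruling D-0035): this cell
ATTEMPTS the negative direction of the Clay problem; nothing in this file is a claim about
Navier–Stokes blow-up. WHAT THIS IS NOT: not a statement about the untruncated equations; it is
the ONE-DYADIC-STEP a-priori estimate of memo Theorem A (`CIRCUIT-OBSTRUCTIONS.md` §A.3 (3)–(4),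
§G.2 with force) instantiated for the FORCED Galerkin system of
`Literature.Analysis.FluidPDE.FluidComputer.GalerkinEnergyBalance` (`IsGalerkinSolution U S ν c f`:
`dû_j(k)/dt = -ν|k|²û_j(k) + N_S(k)_j - c(t,k)k_j + f̂_j(t,k)`, `k ∈ S`, Doering–Gibbon 1995 §5.3, the
system a dealiased pseudo-spectral code integrates), i.e. with the TRUE `(u·∇)u` coefficients on the
finite mode set `S`, arbitrary pressure multipliers `c`, and a force `f̂`.

## What is typed
* `norm_cdot_conj_le`, `norm_kdot_le` — Cauchy–Schwarz for the two pairings of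
  `ShellTransferIdentities` (`cdot`, `kdot`).
* `abs_energyRate_le` — THE STRUCTURAL BOUND: for a field supported in `S`,
  `|energyRate û S k| ≤ |k| · A(k) · Σ_{p∈S, k-p∈S} A(p) A(k-p)` with `A(q) = √(2·modalEnergy û q)
  = |û(q)|` (exact coefficients: `|k·û(k-p)| ≤ |k||û(k-p)|` by Cauchy–Schwarz — the only place the
  Navier–Stokes nonlinearity enters Theorem A).
* `sqrt_knormSq_le_add`, `high_partner` — `|k| ≤ |p| + |k-p|`, hence one partner has modulus `≥ |k|/2`.
* `pair_sum_le'` — the Cauchy–Schwarz pair step of `SparseSupportCeiling.pair_sum_le` for finsets of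
  an arbitrary index type (wavevectors `ℤ³` are not a `Fintype`).
* `sqrt_two_mul_le_max` — the barrier lemma on the modal energy: `φ' ≤ -2dφ + √(2φ)·F` on `[0,T)`
  ⇒ `√(2φ) ≤ max(√(2φ(0)), F/d)` on `[0,T]` (the pressure multiplier never enters: it is
  orthogonal to `û(k)`, `cdot_conj_coeff_parallel`).
* `galerkin_sparse_step` — ONE DYADIC STEP for `IsGalerkinSolution`: if on `[0,T)` the energy obeys
  `Σ_{k∈S} |û(t,k)|² = Σ_{k∈S} 2·modalEnergy ≤ E₀`, the force obeys `|f̂(t,k)| ≤ φ k`, and every mode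
  with `R ≤ 2|q|` has `|û(t,q)| ≤ A`, then every mode with `R ≤ |k|` obeys
  `|û(t,k)| ≤ max(|û(0,k)|, (|k|·(2√E₀ √D_k A) + φ k)/(ν|k|²))`, `D_k = #{p ∈ S : k-p ∈ S}` — the
  recursion `a(R) ≤ b(R) + θ(R) a(R/2) + force tail` with `θ = (2√E₀/ν)·sup √D_k/|k|`.
* `galerkin_energy_bound_unforced` — for `f̂ = 0` the energy hypothesis holds with
  `E₀ = 2·truncEnergy(û(0))` (`truncEnergy_antitone`).

## Honest limits
Finite `S` only (the object the tree has); the passage `S ↑ S_∞` for an infinite sparse set and the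
continuation criterion are the PDE half of Theorem A (memo §A.3 (5), refereed PASS as NS-verbatim).
The iteration over dyadic levels is `SparseSupportCeiling.geometric_ceiling` / `sparse_ceiling`
(sibling file; not imported here).
-/

namespace Summit.NavierStokesRegularity.FluidComputer.SparseGalerkinCeiling

open Set Finset Literature.Analysis.FluidPDE.FluidComputer Literature.Analysis.FluidPDE.FluidComputer.ShellTransfer
open scoped ComplexConjugate

/-! ## Cauchy–Schwarz for the two pairings -/

/-- Cauchy–Schwarz on a finset, two-sided square-root form: `|∑ f g| ≤ √(∑ f²) · √(∑ g²)`. -/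
private theorem abs_sum_mul_le_sqrt_mul_sqrt {ι : Type*} (s : Finset ι) (f g : ι → ℝ) :
    |∑ i ∈ s, f i * g i| ≤ Real.sqrt (∑ i ∈ s, f i ^ 2) * Real.sqrt (∑ i ∈ s, g i ^ 2) := by
  rw [← Real.sqrt_mul (Finset.sum_nonneg fun i _ => sq_nonneg (f i))]
  exact Real.abs_le_sqrt (Finset.sum_mul_sq_le_sq_mul_sq s f g)


/-- `2·modalEnergy û k = Σ_j |û_j(k)|²`. -/
theorem two_mul_modalEnergy (U : FourierVelocity) (k : Fin 3 → ℤ) :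
    2 * modalEnergy U k = ∑ j, Complex.normSq (U.coeff k j) := by
  unfold modalEnergy; ring

/-- Cauchy–Schwarz for the bilinear pairing with a conjugate: `|conj a · b| ≤ |a| |b|`. -/
theorem norm_cdot_conj_le (a b : Fin 3 → ℂ) :
    ‖cdot (fun j => conj (a j)) b‖ ≤
      Real.sqrt (∑ j, Complex.normSq (a j)) * Real.sqrt (∑ j, Complex.normSq (b j)) := by
  unfold cdot
  calc ‖∑ j, conj (a j) * b j‖ ≤ ∑ j, ‖conj (a j) * b j‖ := norm_sum_le _ _
    _ = ∑ j, ‖a j‖ * ‖b j‖ := by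
        refine Finset.sum_congr rfl fun j _ => ?_
        rw [norm_mul, Complex.norm_conj]
    _ ≤ Real.sqrt (∑ j, ‖a j‖ ^ 2) * Real.sqrt (∑ j, ‖b j‖ ^ 2) :=
        (le_abs_self _).trans (abs_sum_mul_le_sqrt_mul_sqrt _ _ _)
    _ = Real.sqrt (∑ j, Complex.normSq (a j)) * Real.sqrt (∑ j, Complex.normSq (b j)) := by
        simp only [Complex.normSq_eq_norm_sq]

/-- Cauchy–Schwarz for the wavevector pairing: `|k · a| ≤ |k| |a|`. -/
theorem norm_kdot_le (k : Fin 3 → ℤ) (a : Fin 3 → ℂ) :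
    ‖kdot k a‖ ≤ Real.sqrt (knormSq k) * Real.sqrt (∑ j, Complex.normSq (a j)) := by
  unfold kdot knormSq
  calc ‖∑ j, ((k j : ℤ) : ℂ) * a j‖ ≤ ∑ j, ‖((k j : ℤ) : ℂ) * a j‖ := norm_sum_le _ _
    _ = ∑ j, |((k j : ℤ) : ℝ)| * ‖a j‖ := by
        refine Finset.sum_congr rfl fun j _ => ?_
        rw [norm_mul, Complex.norm_intCast]
    _ ≤ Real.sqrt (∑ j, |((k j : ℤ) : ℝ)| ^ 2) * Real.sqrt (∑ j, ‖a j‖ ^ 2) :=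
        (le_abs_self _).trans (abs_sum_mul_le_sqrt_mul_sqrt _ _ _)
    _ = Real.sqrt (∑ j, ((k j : ℤ) : ℝ) ^ 2) * Real.sqrt (∑ j, Complex.normSq (a j)) := by
        simp only [sq_abs, Complex.normSq_eq_norm_sq]

/-! ## The structural bound on the transfer into one mode -/

/-- One mode-to-mode transfer is bounded by `|k| |û(k-p)| |û(k)| |û(p)|`. -/
theorem abs_modeTransfer_le (U : FourierVelocity) (k p : Fin 3 → ℤ) :
    |modeTransfer U k p| ≤ Real.sqrt (knormSq k) * Real.sqrt (2 * modalEnergy U (k - p)) *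
      (Real.sqrt (2 * modalEnergy U k) * Real.sqrt (2 * modalEnergy U p)) := by
  unfold modeTransfer
  refine (Complex.abs_im_le_norm _).trans ?_
  rw [norm_mul, two_mul_modalEnergy, two_mul_modalEnergy, two_mul_modalEnergy]
  exact mul_le_mul (norm_kdot_le _ _) (norm_cdot_conj_le _ _) (norm_nonneg _) (by positivity)

/-- **The structural bound** (memo §A.3 step (2)–(3), exact coefficients): for a field whose
coefficients vanish off `S`,
`|energyRate û S k| ≤ |k| · |û(k)| · Σ_{p ∈ S, k-p ∈ S} |û(p)| |û(k-p)|`. -/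
theorem abs_energyRate_le (U : FourierVelocity) (S : Finset (Fin 3 → ℤ)) (k : Fin 3 → ℤ)
    (hoff : ∀ q ∉ S, U.coeff q = 0) :
    |energyRate U S k| ≤ Real.sqrt (knormSq k) * Real.sqrt (2 * modalEnergy U k) *
      ∑ p ∈ S.filter (fun p => k - p ∈ S),
        Real.sqrt (2 * modalEnergy U p) * Real.sqrt (2 * modalEnergy U (k - p)) := by
  unfold energyRate
  refine (Finset.abs_sum_le_sum_abs _ _).trans ?_
  rw [← Finset.sum_filter_add_sum_filter_not S (fun p => k - p ∈ S)]
  have hzero : ∑ p ∈ S.filter (fun p => ¬ (k - p ∈ S)), |modeTransfer U k p| = 0 := by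
    refine Finset.sum_eq_zero fun p hp => ?_
    have hq : U.coeff (k - p) = 0 := hoff _ (Finset.mem_filter.mp hp).2
    unfold modeTransfer kdot
    simp [hq]
  rw [hzero, add_zero, Finset.mul_sum]
  refine Finset.sum_le_sum fun p _ => ?_
  calc |modeTransfer U k p|
      ≤ Real.sqrt (knormSq k) * Real.sqrt (2 * modalEnergy U (k - p)) *
          (Real.sqrt (2 * modalEnergy U k) * Real.sqrt (2 * modalEnergy U p)) :=
        abs_modeTransfer_le U k p
    _ = Real.sqrt (knormSq k) * Real.sqrt (2 * modalEnergy U k) *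
          (Real.sqrt (2 * modalEnergy U p) * Real.sqrt (2 * modalEnergy U (k - p))) := by ring

/-- The injection term is bounded by `|û(k)| |f̂(k)|`. -/
theorem abs_injection_le (U : FourierVelocity) (g : Fin 3 → ℂ) (k : Fin 3 → ℤ) :
    |(cdot (fun j => conj (U.coeff k j)) g).re| ≤
      Real.sqrt (2 * modalEnergy U k) * Real.sqrt (∑ j, Complex.normSq (g j)) := by
  rw [two_mul_modalEnergy]
  exact (Complex.abs_re_le_norm _).trans (norm_cdot_conj_le _ _)

/-! ## Geometry of a triad: one partner is at least half as large -/

/-- Minkowski in `ℝ³` for integer wavevectors: `|p + q| ≤ |p| + |q|`. -/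
theorem sqrt_knormSq_add_le (p q : Fin 3 → ℤ) :
    Real.sqrt (knormSq (p + q)) ≤ Real.sqrt (knormSq p) + Real.sqrt (knormSq q) := by
  have hp : 0 ≤ Real.sqrt (knormSq p) := Real.sqrt_nonneg _
  have hq : 0 ≤ Real.sqrt (knormSq q) := Real.sqrt_nonneg _
  rw [Real.sqrt_le_left (by positivity)]
  have hcs : ∑ j, ((p j : ℤ) : ℝ) * ((q j : ℤ) : ℝ) ≤ Real.sqrt (knormSq p) * Real.sqrt (knormSq q) := by
    unfold knormSq
    exact (le_abs_self _).trans (abs_sum_mul_le_sqrt_mul_sqrt _ _ _)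
  have hexp : knormSq (p + q) = knormSq p + 2 * ∑ j, ((p j : ℤ) : ℝ) * ((q j : ℤ) : ℝ) + knormSq q := by
    unfold knormSq
    rw [Finset.mul_sum, ← Finset.sum_add_distrib, ← Finset.sum_add_distrib]
    refine Finset.sum_congr rfl fun j _ => ?_
    simp only [Pi.add_apply, Int.cast_add]
    ring
  rw [hexp, add_sq, Real.sq_sqrt (knormSq_nonneg p), Real.sq_sqrt (knormSq_nonneg q)]
  linarith

/-- In the triad `(k; p, k-p)` one of `p`, `k-p` has modulus at least `|k|/2`. -/
theorem high_partner (k p : Fin 3 → ℤ) :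
    Real.sqrt (knormSq k) ≤ 2 * Real.sqrt (knormSq p) ∨
      Real.sqrt (knormSq k) ≤ 2 * Real.sqrt (knormSq (k - p)) := by
  have h := sqrt_knormSq_add_le p (k - p)
  rw [add_sub_cancel] at h
  rcases le_total (Real.sqrt (knormSq (k - p))) (Real.sqrt (knormSq p)) with h1 | h1
  · left; linarith
  · right; linarith

/-! ## The pair step for finsets of an arbitrary index type -/

/-- `SparseSupportCeiling.pair_sum_le` for an arbitrary index type: `N ⊆ S`, `σ` maps `N` into
`S` injectively, `Σ_{S} v² ≤ E₀`, every pair has a "high" member (`P`), high members are `≤ a` ⇒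
`Σ_{j∈N} v j · v (σ j) ≤ 2 √E₀ √#N a`. -/
theorem pair_sum_le' {α : Type*} [DecidableEq α] (S N : Finset α) (hN : N ⊆ S) (σ : α → α)
    (hσS : ∀ j ∈ N, σ j ∈ S) (hσ : Set.InjOn σ ↑N) (v : α → ℝ) (hv : ∀ i, 0 ≤ v i) {E₀ : ℝ}
    (hE : ∑ i ∈ S, v i ^ 2 ≤ E₀) (P : α → Prop) [DecidablePred P]
    (hP : ∀ j ∈ N, P j ∨ P (σ j)) {a : ℝ} (ha0 : 0 ≤ a) (ha : ∀ i ∈ S, P i → v i ≤ a) :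
    ∑ j ∈ N, v j * v (σ j) ≤ 2 * Real.sqrt E₀ * Real.sqrt N.card * a := by
  have hsplit : ∑ j ∈ N, v j * v (σ j) =
      ∑ j ∈ N.filter (fun j => P (σ j)), v j * v (σ j) +
        ∑ j ∈ N.filter (fun j => ¬ P (σ j)), v j * v (σ j) :=
    (Finset.sum_filter_add_sum_filter_not N (fun j => P (σ j)) _).symm
  set N₁ := N.filter (fun j => P (σ j)) with hN₁
  set N₂ := N.filter (fun j => ¬ P (σ j)) with hN₂
  have hN₁N : N₁ ⊆ N := Finset.filter_subset _ _
  have hN₂N : N₂ ⊆ N := Finset.filter_subset _ _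
  have hsq_a : ∀ i ∈ S, P i → v i ^ 2 ≤ a ^ 2 := fun i hi hPi => pow_le_pow_left₀ (hv i) (ha i hi hPi) 2
  have hsqrt_card : Real.sqrt (N.card * a ^ 2) = Real.sqrt N.card * a := by
    rw [Real.sqrt_mul (Nat.cast_nonneg _), Real.sqrt_sq ha0]
  have hsumS : ∀ M : Finset α, M ⊆ S → ∑ j ∈ M, v j ^ 2 ≤ E₀ := fun M hM =>
    le_trans (Finset.sum_le_sum_of_subset_of_nonneg hM fun i _ _ => sq_nonneg (v i)) hE
  -- part 1
  have h1a : ∑ j ∈ N₁, v j ^ 2 ≤ E₀ := hsumS N₁ (hN₁N.trans hN)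
  have h1b : ∑ j ∈ N₁, v (σ j) ^ 2 ≤ N.card * a ^ 2 := by
    calc ∑ j ∈ N₁, v (σ j) ^ 2 ≤ ∑ j ∈ N₁, a ^ 2 :=
          Finset.sum_le_sum fun j hj =>
            hsq_a _ (hσS j (hN₁N hj)) (Finset.mem_filter.mp hj).2
      _ = N₁.card * a ^ 2 := by rw [Finset.sum_const, nsmul_eq_mul]
      _ ≤ N.card * a ^ 2 := by gcongr
  have hpart1 : ∑ j ∈ N₁, v j * v (σ j) ≤ Real.sqrt E₀ * (Real.sqrt N.card * a) := by
    refine ((le_abs_self _).trans (abs_sum_mul_le_sqrt_mul_sqrt N₁ (fun j => v j) (fun j => v (σ j)))).trans ?_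
    rw [← hsqrt_card]
    exact mul_le_mul (Real.sqrt_le_sqrt h1a) (Real.sqrt_le_sqrt h1b) (Real.sqrt_nonneg _)
      (Real.sqrt_nonneg _)
  -- part 2
  have h2a : ∑ j ∈ N₂, v j ^ 2 ≤ N.card * a ^ 2 := by
    calc ∑ j ∈ N₂, v j ^ 2 ≤ ∑ j ∈ N₂, a ^ 2 := Finset.sum_le_sum fun j hj => by
            have hj' := Finset.mem_filter.mp hj
            rcases hP j hj'.1 with h | h
            · exact hsq_a j (hN hj'.1) h
            · exact absurd h hj'.2
      _ = N₂.card * a ^ 2 := by rw [Finset.sum_const, nsmul_eq_mul]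
      _ ≤ N.card * a ^ 2 := by gcongr
  have hσ₂ : Set.InjOn σ ↑N₂ := hσ.mono (fun j hj => (Finset.mem_filter.mp hj).1)
  have himg : N₂.image σ ⊆ S := by
    intro i hi
    obtain ⟨j, hj, rfl⟩ := Finset.mem_image.mp hi
    exact hσS j (hN₂N hj)
  have h2b : ∑ j ∈ N₂, v (σ j) ^ 2 ≤ E₀ := by
    rw [show ∑ j ∈ N₂, v (σ j) ^ 2 = ∑ i ∈ N₂.image σ, v i ^ 2 from
      (Finset.sum_image (f := fun i => v i ^ 2) hσ₂).symm]
    exact hsumS _ himg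
  have hpart2 : ∑ j ∈ N₂, v j * v (σ j) ≤ (Real.sqrt N.card * a) * Real.sqrt E₀ := by
    refine ((le_abs_self _).trans (abs_sum_mul_le_sqrt_mul_sqrt N₂ (fun j => v j) (fun j => v (σ j)))).trans ?_
    rw [← hsqrt_card]
    exact mul_le_mul (Real.sqrt_le_sqrt h2a) (Real.sqrt_le_sqrt h2b) (Real.sqrt_nonneg _)
      (Real.sqrt_nonneg _)
  rw [hsplit]
  nlinarith [hpart1, hpart2, Real.sqrt_nonneg E₀, Real.sqrt_nonneg (N.card : ℝ), ha0]

/-! ## The barrier lemma on the modal energy -/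

/-- Barrier for a modal energy `φ ≥ 0`: if `φ' ≤ -2dφ + √(2φ)·F` on `[0,T)` (right derivatives,
`φ` continuous on `[0,T]`, `d > 0`), then `√(2φ(t)) ≤ max(√(2φ(0)), F/d)` on `[0,T]`. -/
theorem sqrt_two_mul_le_max {φ φ' : ℝ → ℝ} {d F T : ℝ} (hd : 0 < d)
    (hcont : ContinuousOn φ (Icc 0 T))
    (hderiv : ∀ s ∈ Ico 0 T, HasDerivWithinAt φ (φ' s) (Ici s) s)
    (hpos : ∀ s ∈ Icc 0 T, 0 ≤ φ s)
    (hineq : ∀ s ∈ Ico 0 T, φ' s ≤ -(2 * d) * φ s + Real.sqrt (2 * φ s) * F) :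
    ∀ t ∈ Icc 0 T, Real.sqrt (2 * φ t) ≤ max (Real.sqrt (2 * φ 0)) (F / d) := by
  intro t ht
  apply le_of_forall_gt_imp_ge_of_dense
  intro M hM
  have hM0 : Real.sqrt (2 * φ 0) < M := lt_of_le_of_lt (le_max_left _ _) hM
  have hMF : F / d < M := lt_of_le_of_lt (le_max_right _ _) hM
  have hMpos : 0 < M := lt_of_le_of_lt (Real.sqrt_nonneg _) hM0
  have hFdM : F < d * M := by rwa [div_lt_iff₀ hd, mul_comm] at hMF
  have hB : ContinuousOn (fun _ : ℝ => M ^ 2 / 2) (Icc 0 T) := continuousOn_const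
  have hB' : ∀ s ∈ Ico 0 T,
      HasDerivWithinAt (fun _ : ℝ => M ^ 2 / 2) ((fun _ : ℝ => (0 : ℝ)) s) (Ici s) s :=
    fun s _ => hasDerivWithinAt_const _ _ _
  have h0 : φ 0 ≤ (fun _ : ℝ => M ^ 2 / 2) 0 := by
    simp only
    have h2 : 2 * φ 0 < M ^ 2 := by
      have hφ0 : 0 ≤ 2 * φ 0 := by
        have := hpos 0 (left_mem_Icc.mpr (ht.1.trans ht.2)); linarith
      have := Real.sq_sqrt hφ0
      nlinarith [Real.sqrt_nonneg (2 * φ 0)]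
    linarith
  have hbound : ∀ s ∈ Ico 0 T, φ s = (fun _ : ℝ => M ^ 2 / 2) s → φ' s < (fun _ : ℝ => (0 : ℝ)) s := by
    intro s hs hEq
    simp only at hEq ⊢
    have hsq : Real.sqrt (2 * φ s) = M := by
      rw [hEq, show 2 * (M ^ 2 / 2) = M ^ 2 by ring, Real.sqrt_sq hMpos.le]
    have h1 := hineq s hs
    rw [hsq, hEq] at h1
    nlinarith
  have key := image_le_of_deriv_right_lt_deriv_boundary' hcont hderiv h0 hB hB' hbound ht
  try simp only at key
  have h2t : 0 ≤ 2 * φ t := by have := hpos t ht; linarith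
  calc Real.sqrt (2 * φ t) ≤ Real.sqrt (M ^ 2) := Real.sqrt_le_sqrt (by linarith)
    _ = M := Real.sqrt_sq hMpos.le

/-! ## One dyadic step for the Galerkin system -/

/-- **ONE DYADIC STEP of the sparse-support ceiling for the tree's forced Galerkin Navier–Stokes
system** (memo Theorem A, §A.3 (3)–(4) / §G.2). Let `U` solve `IsGalerkinSolution U S ν c f`
(any pressure multipliers `c`), be supported in `S`, with `ν > 0`; on `[0,T)` let the energy obey
`Σ_{k∈S} |û(t,k)|² ≤ E₀`, the force `|f̂(t,k)| ≤ φ k`, and every mode with `R ≤ 2|q|` satisfy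
`|û(t,q)| ≤ A`. Then every mode `k ∈ S` with `R ≤ |k|` (`R > 0`) obeys, for `t ∈ [0,T]`,
`|û(t,k)| ≤ max (|û(0,k)|) ((|k|·(2√E₀·√D_k·A) + φ k)/(ν|k|²))`, `D_k = #{p ∈ S : k - p ∈ S}`.
Here `|û(q)| = √(2·modalEnergy û q)`, `|k| = √(knormSq k)`. -/
theorem galerkin_sparse_step {U : ℝ → FourierVelocity} {S : Finset (Fin 3 → ℤ)} {ν : ℝ}
    {c : ℝ → (Fin 3 → ℤ) → ℂ} {f : ℝ → (Fin 3 → ℤ) → Fin 3 → ℂ}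
    (hU : IsGalerkinSolution U S ν c f) (hsupp : IsSupportedOn U S) (hν : 0 < ν)
    {T E₀ R A : ℝ} {φ : (Fin 3 → ℤ) → ℝ}
    (henergy : ∀ t ∈ Ico 0 T, ∑ k ∈ S, 2 * modalEnergy (U t) k ≤ E₀)
    (hforce : ∀ t ∈ Ico 0 T, ∀ k ∈ S, Real.sqrt (∑ j, Complex.normSq (f t k j)) ≤ φ k)
    (hR : 0 < R) (hA0 : 0 ≤ A)
    (hA : ∀ t ∈ Ico 0 T, ∀ q ∈ S, R ≤ 2 * Real.sqrt (knormSq q) →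
      Real.sqrt (2 * modalEnergy (U t) q) ≤ A) :
    ∀ k ∈ S, R ≤ Real.sqrt (knormSq k) → ∀ t ∈ Icc 0 T,
      Real.sqrt (2 * modalEnergy (U t) k) ≤ max (Real.sqrt (2 * modalEnergy (U 0) k))
        ((Real.sqrt (knormSq k) * (2 * Real.sqrt E₀ * Real.sqrt (S.filter (fun p => k - p ∈ S)).card * A)
          + φ k) / (ν * knormSq k)) := by
  intro k hk hRk t ht
  have hκpos : 0 < Real.sqrt (knormSq k) := lt_of_lt_of_le hR hRk
  have hκ2pos : 0 < knormSq k := Real.sqrt_pos.mp hκpos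
  have hd : 0 < ν * knormSq k := mul_pos hν hκ2pos
  -- the modal energy and its derivative along the Galerkin flow
  have hder := fun s => hasDerivAt_modalEnergy_galerkin hU s hk
  have hcont : ContinuousOn (fun s => modalEnergy (U s) k) (Icc 0 T) :=
    fun s _ => (hder s).continuousAt.continuousWithinAt
  set Fk := Real.sqrt (knormSq k) * (2 * Real.sqrt E₀ *
      Real.sqrt (S.filter (fun p => k - p ∈ S)).card * A) + φ k with hFk
  have key := sqrt_two_mul_le_max (φ := fun s => modalEnergy (U s) k) (d := ν * knormSq k) (F := Fk)
    (T := T) hd hcont (fun s _ => (hder s).hasDerivWithinAt)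
    (fun s _ => modalEnergy_nonneg _ _) ?_ t ht
  · simpa [hFk] using key
  -- the differential inequality on [0,T)
  intro s hs
  have hoff : ∀ q ∉ S, (U s).coeff q = 0 := fun q hq => hsupp s q hq
  have hE := abs_energyRate_le (U s) S k hoff
  have hI := abs_injection_le (U s) (f s k) k
  -- the pair sum, by the Cauchy–Schwarz step
  have hpair : ∑ p ∈ S.filter (fun p => k - p ∈ S),
      Real.sqrt (2 * modalEnergy (U s) p) * Real.sqrt (2 * modalEnergy (U s) (k - p)) ≤
        2 * Real.sqrt E₀ * Real.sqrt (S.filter (fun p => k - p ∈ S)).card * A := by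
    refine pair_sum_le' S (S.filter (fun p => k - p ∈ S)) (Finset.filter_subset _ _)
      (fun p => k - p) (fun p hp => (Finset.mem_filter.mp hp).2)
      (fun p _ q _ h => sub_right_injective h)
      (fun q => Real.sqrt (2 * modalEnergy (U s) q)) (fun q => Real.sqrt_nonneg _) ?_
      (fun q => R ≤ 2 * Real.sqrt (knormSq q)) ?_ hA0 (fun q hq hPq => hA s hs q hq hPq)
    · calc ∑ q ∈ S, Real.sqrt (2 * modalEnergy (U s) q) ^ 2
          = ∑ q ∈ S, 2 * modalEnergy (U s) q :=
            Finset.sum_congr rfl fun q _ =>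
              Real.sq_sqrt (by have := modalEnergy_nonneg (U s) q; linarith)
        _ ≤ E₀ := henergy s hs
    · intro p _
      rcases high_partner k p with h | h
      · left; linarith
      · right; linarith
  have hF0 : |energyRate (U s) S k| + |(cdot (fun j => conj ((U s).coeff k j)) (f s k)).re| ≤
      Real.sqrt (2 * modalEnergy (U s) k) * Fk := by
    have h1 : Real.sqrt (knormSq k) * Real.sqrt (2 * modalEnergy (U s) k) *
        ∑ p ∈ S.filter (fun p => k - p ∈ S),
          Real.sqrt (2 * modalEnergy (U s) p) * Real.sqrt (2 * modalEnergy (U s) (k - p)) ≤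
        Real.sqrt (knormSq k) * Real.sqrt (2 * modalEnergy (U s) k) *
          (2 * Real.sqrt E₀ * Real.sqrt (S.filter (fun p => k - p ∈ S)).card * A) :=
      mul_le_mul_of_nonneg_left hpair (by positivity)
    have h2 : Real.sqrt (2 * modalEnergy (U s) k) * Real.sqrt (∑ j, Complex.normSq (f s k j)) ≤
        Real.sqrt (2 * modalEnergy (U s) k) * φ k :=
      mul_le_mul_of_nonneg_left (hforce s hs k hk) (Real.sqrt_nonneg _)
    rw [hFk]
    nlinarith [hE, hI, h1, h2, Real.sqrt_nonneg (2 * modalEnergy (U s) k), Real.sqrt_nonneg (knormSq k)]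
  have hEr := le_abs_self (energyRate (U s) S k)
  have hIr := le_abs_self ((cdot (fun j => conj ((U s).coeff k j)) (f s k)).re)
  try simp only
  nlinarith [hF0, hEr, hIr]

/-- For the UNFORCED Galerkin system (`f̂ = 0`, `ν ≥ 0`) the energy hypothesis of
`galerkin_sparse_step` holds on every `[0,T)` with `E₀ = Σ_{k∈S} |û(0,k)|²` (energy decay,
`truncEnergy_antitone`). -/
theorem galerkin_energy_bound_unforced {U : ℝ → FourierVelocity} {S : Finset (Fin 3 → ℤ)} {ν : ℝ}
    (hν : 0 ≤ ν) {c : ℝ → (Fin 3 → ℤ) → ℂ} (hU : IsGalerkinSolution U S ν c fun _ _ _ => 0)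
    {T : ℝ} : ∀ t ∈ Ico 0 T, ∑ k ∈ S, 2 * modalEnergy (U t) k ≤ ∑ k ∈ S, 2 * modalEnergy (U 0) k := by
  intro t ht
  have h := truncEnergy_antitone hν hU ht.1
  unfold truncEnergy at h
  rw [← Finset.mul_sum, ← Finset.mul_sum]
  linarith

end Summit.NavierStokesRegularity.FluidComputer.SparseGalerkinCeiling
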